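import Literature.Barriers.RiemannHypothesis.MollifierLimitationsPropBMoments
import Literature.Barriers.RiemannHypothesis.MollifierLimitationsPropBQuadFormScaled
import Literature.NumberTheory.LFunctions.HardyZSqTwistedMoment
import HarnessLib

/-!
# Radziwiłł 2012, Proposition B without BCH, part E: the resonant terms and the quadratic form

Fifth file of the BCH-free proof of `Literature.Barriers.RiemannHypothesis.Radziwill2012_propB`
(M. Radziwiłł, *Limitations to mollifying ζ(s)*, arXiv:1207.6583, Proposition B). Part D
(`MollifierLimitationsPropBMoments.lean`) reduced the windowed twisted first moment
`∫ w ζ S̄ M M̄` to its resonant part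
`D₂ = ∑_{nh = ℓk} a(k) ā(h) (ℓnkh)^{-1/2} ∫ w(t) ρ_n(t) dt` (`PropBMoments.I2diag`). Here:

* the resonant quadruples are parametrised: with `g = (k,h)`, `k = gk'`, `h = gh'`, the solutions of
  `nh = ℓk` are `n = k'j`, `ℓ = h'j`, and `(ℓnkh)^{-1/2} = 1/([k,h] j)`, so
  `D₂ = ∑_{k,h ≤ N} a(k)ā(h)/[k,h] · ∫ w(t) H_{k'}(t) dt`, `H_q(t) = ∑_j ρ_{qj}(t)/j`
  (`I2diag_eq_sum_lcm`);
* the smoothly weighted harmonic sums are evaluated: `H_q(t) = log(x₀(t)/q) + γ + O(q/x₀(t))`,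
  `x₀(t) = √(t/2π)` (`abs_Hsum_sub_le`) — by the averaging identity `ρ_m = ∫ φ(v) 𝟙[m ≤ e^v x₀] dv`
  this is `∫ φ(v) H(⌊e^v x₀/q⌋) dv` with the harmonic numbers `H(m) = log m + γ + O(1/m)`, and
  `∫ v φ(v) dv = 0` because `φ` is even;
* hence `2 Re D₂ = ∫ w(t) 𝒬(t) dt + O(T^{1/2} ∑|a(k)| ∑|a(h)|/h)` with the pointwise quadratic form
  `𝒬(t) = ∑_{k,h} Re(a(k)ā(h))/[k,h] (log(t(k,h)²/(2πkh)) + 2γ) = bchQuadForm (et/4) N a`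
  (`two_re_I2diag_sub_le`, `PropB.bchQuadForm_rescale`).

Everything is PROVED; no named facts.

## References

* [Radziwill2012] M. Radziwiłł, *Limitations to mollifying ζ(s)*, arXiv:1207.6583 (2012), Prop. B
  and §7 (the quadratic form (7.1)).
* [Titchmarsh1986] E. C. Titchmarsh, *The Theory of the Riemann Zeta-Function*, 2nd ed., §7.2.
-/

noncomputable section

open Complex MeasureTheory Set Filter Finset Real
open scoped Real Topology ComplexConjugate ContDiff

namespace Literature.Barriers.RiemannHypothesis

namespace PropBResonant

open Literature.Analysis.Fourier Literature.NumberTheory.LFunctions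
open Literature.NumberTheory.LFunctions.SelfDualAFE
open Literature.NumberTheory.LFunctions.TwistedMoment (abs_harmonic_sub_log_sub_gamma_le)
open PropBMoments

/-! ### The density is even: `∫ v φ(v) dv = 0` -/

/-- `∫_{-κ}^{κ} v φ_κ(v) dv = 0` (`φ_κ` is even). [folklore] -/
theorem integral_mul_logDensity_eq_zero {κ : ℝ} (hκ : 0 < κ) :
    ∫ v in -κ..κ, v * logDensity κ v = 0 := by
  have h := intervalIntegral.integral_comp_neg (a := -κ) (b := κ) (fun v => v * logDensity κ v)
  simp only [neg_neg] at h
  -- `h : ∫ v in -κ..κ, (-v) * φ(-v) = ∫ v in -κ..κ, v φ(v)`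
  have h2 : (∫ v in -κ..κ, (-v) * logDensity κ (-v)) = -∫ v in -κ..κ, v * logDensity κ v := by
    rw [← intervalIntegral.integral_neg]
    refine intervalIntegral.integral_congr fun v _ => ?_
    simp only [logDensity_neg hκ.ne', neg_mul]
  linarith [h.symm.trans h2]

/-! ### The smoothly weighted harmonic sums `H_q(t) = ∑_j ρ_{qj}(t)/j` -/

/-- `H_q(t) = ∑_{j ≤ N_s/q} ρ_{qj}(t)/j` (all non-zero terms are included once `e^κ x₀(t) ≤ N_s`).
[folklore] -/
def Hsum (κ : ℝ) (q Ns : ℕ) (t : ℝ) : ℝ := ∑ j ∈ Finset.Icc 1 (Ns / q), weight κ (q * j) t / j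

/-- Unfolding lemma. [folklore] -/
theorem Hsum_def (κ : ℝ) (q Ns : ℕ) (t : ℝ) :
    Hsum κ q Ns t = ∑ j ∈ Finset.Icc 1 (Ns / q), weight κ (q * j) t / j := rfl

/-- For `j, q ≥ 1`, `x₀ > 0`: `log(qj) − log x₀ ≤ v ↔ j ≤ ⌊e^v x₀/q⌋`. [folklore] -/
theorem log_mul_sub_le_iff {q j : ℕ} (hq : 1 ≤ q) (hj : 1 ≤ j) {x₀ v : ℝ} (hx₀ : 0 < x₀) :
    Real.log ((q * j : ℕ) : ℝ) - Real.log x₀ ≤ v ↔ j ≤ ⌊Real.exp v * x₀ / q⌋₊ := by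
  have hqR : (0 : ℝ) < q := by exact_mod_cast hq
  have hjR : (0 : ℝ) < j := by exact_mod_cast hj
  have hqj : (0 : ℝ) < ((q * j : ℕ) : ℝ) := by push_cast; positivity
  rw [Nat.le_floor_iff (by positivity), le_div_iff₀ hqR, sub_le_iff_le_add]
  constructor
  · intro h
    have h' := Real.exp_le_exp.2 h
    rw [Real.exp_log hqj, Real.exp_add, Real.exp_log hx₀] at h'
    push_cast at h'; linarith
  · intro h
    have h' : ((q * j : ℕ) : ℝ) ≤ Real.exp v * x₀ := by push_cast; linarith
    have := Real.log_le_log hqj h'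
    rwa [Real.log_mul (Real.exp_pos v).ne' hx₀.ne', Real.log_exp] at this

/-- **The weighted harmonic sum.** For `κ > 0`, `q ≥ 1`, `t > 0`, `x₀ = √(t/2π)` with
`e^κ x₀ ≤ N_s` and `2q ≤ e^{-κ} x₀`: `|H_q(t) − (log(x₀/q) + γ)| ≤ 4 e^κ q/x₀`. [folklore] -/
theorem abs_Hsum_sub_le {κ : ℝ} (hκ : 0 < κ) {q Ns : ℕ} (hq : 1 ≤ q) {t : ℝ} (ht : 0 < t)
    (hNs : Real.exp κ * Real.sqrt (t / (2 * π)) ≤ Ns)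
    (hq2 : 2 * (q : ℝ) ≤ Real.exp (-κ) * Real.sqrt (t / (2 * π))) :
    |Hsum κ q Ns t - (Real.log (Real.sqrt (t / (2 * π)) / q) + Real.eulerMascheroniConstant)|
      ≤ 4 * Real.exp κ * q / Real.sqrt (t / (2 * π)) := by
  have hπ := Real.pi_pos
  set x₀ : ℝ := Real.sqrt (t / (2 * π)) with hx₀
  have hx₀pos : 0 < x₀ := Real.sqrt_pos.2 (by positivity)
  have hqR : (0 : ℝ) < q := by exact_mod_cast hq
  set γ : ℝ := Real.eulerMascheroniConstant
  set c : ℝ := Real.log (x₀ / q) + γ with hc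
  set Bd : ℝ := 4 * Real.exp κ * q / x₀ with hBd
  -- the indicator representation of the weights
  have hw : ∀ j ∈ Finset.Icc 1 (Ns / q), weight κ (q * j) t
      = ∫ v in -κ..κ, logDensity κ v * indGe (Real.log ((q * j : ℕ) : ℝ) - Real.log x₀) v := by
    intro j _
    rw [integral_logDensity_mul_indGe hκ, weight_def]
  -- the function `G(v) = ∑_j 𝟙[log(qj) − log x₀ ≤ v]/j`
  set G : ℝ → ℝ := fun v => ∑ j ∈ Finset.Icc 1 (Ns / q),
    indGe (Real.log ((q * j : ℕ) : ℝ) - Real.log x₀) v / j with hG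
  have hint_j : ∀ j ∈ Finset.Icc 1 (Ns / q), IntervalIntegrable
      (fun v => logDensity κ v * indGe (Real.log ((q * j : ℕ) : ℝ) - Real.log x₀) v / j) volume (-κ) κ := by
    intro j _
    exact (intervalIntegrable_continuous_mul (continuous_logDensity κ) (measurable_indGe _)
      (abs_indGe_le_one _) _ _).div_const _
  have hHsum : Hsum κ q Ns t = ∫ v in -κ..κ, logDensity κ v * G v := by
    rw [Hsum_def]
    have : (fun v => logDensity κ v * G v) = fun v => ∑ j ∈ Finset.Icc 1 (Ns / q),
        logDensity κ v * indGe (Real.log ((q * j : ℕ) : ℝ) - Real.log x₀) v / j := by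
      funext v; simp only [hG, Finset.mul_sum]; refine Finset.sum_congr rfl fun j _ => ?_; ring
    rw [this, intervalIntegral.integral_finsetSum hint_j]
    refine Finset.sum_congr rfl fun j hj => ?_
    rw [hw j hj, ← intervalIntegral.integral_div]
  -- pointwise: `G(v) = H(⌊e^v x₀/q⌋)` and its distance to `v + c`
  have hGv : ∀ v ∈ Set.Icc (-κ) κ, |G v - (v + c)| ≤ Bd := by
    intro v hv
    set m : ℕ := ⌊Real.exp v * x₀ / q⌋₊ with hm
    -- `m ≤ Ns/q`
    have hmle : m ≤ Ns / q := by
      rw [hm, Nat.floor_div_natCast]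
      exact Nat.div_le_div_right (Nat.floor_le_of_le (by
        calc Real.exp v * x₀ ≤ Real.exp κ * x₀ :=
              mul_le_mul_of_nonneg_right (Real.exp_le_exp.2 hv.2) hx₀pos.le
          _ ≤ Ns := hNs))
    -- `m ≥ 2`... precisely `e^v x₀/q ≥ 2`
    have hy2 : 2 ≤ Real.exp v * x₀ / q := by
      rw [le_div_iff₀ hqR]
      calc 2 * (q : ℝ) ≤ Real.exp (-κ) * x₀ := hq2
        _ ≤ Real.exp v * x₀ := mul_le_mul_of_nonneg_right (Real.exp_le_exp.2 hv.1) hx₀pos.le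
    have hm1 : 1 ≤ m := Nat.le_floor (by simp only [Nat.cast_one]; linarith)
    have hmR : (1 : ℝ) ≤ m := by exact_mod_cast hm1
    -- `G v = ∑_{j ≤ m} 1/j`
    have hGeq : G v = ∑ j ∈ Finset.Icc 1 m, (1 : ℝ) / j := by
      simp only [hG]
      rw [← Finset.sum_subset (Finset.Icc_subset_Icc_right hmle)]
      · refine Finset.sum_congr rfl fun j hj => ?_
        have hj1 := (Finset.mem_Icc.1 hj).1
        rw [indGe_apply, if_pos ((log_mul_sub_le_iff hq hj1 hx₀pos).2 (Finset.mem_Icc.1 hj).2)]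
      · intro j hj hjm
        have hj1 := (Finset.mem_Icc.1 hj).1
        have : ¬ j ≤ m := fun h => hjm (Finset.mem_Icc.2 ⟨hj1, h⟩)
        rw [indGe_apply, if_neg (fun h => this ((log_mul_sub_le_iff hq hj1 hx₀pos).1 h)), zero_div]
    -- harmonic numbers
    have hH := abs_harmonic_sub_log_sub_gamma_le hm1
    -- `|log m − (v + log x₀ − log q)| ≤ 1/m`
    have hy : (m : ℝ) ≤ Real.exp v * x₀ / q := Nat.floor_le (by positivity)
    have hy' : Real.exp v * x₀ / q < m + 1 := Nat.lt_floor_add_one _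
    have hlogy : Real.log (Real.exp v * x₀ / q) = v + Real.log x₀ - Real.log q := by
      rw [Real.log_div (by positivity) hqR.ne', Real.log_mul (Real.exp_pos v).ne' hx₀pos.ne', Real.log_exp]
    have hlogm : |Real.log m - (v + Real.log x₀ - Real.log q)| ≤ 1 / m := by
      rw [← hlogy, abs_sub_comm, abs_of_nonneg (by
        have := Real.log_le_log (by positivity) hy; linarith)]
      have h1 : Real.log (Real.exp v * x₀ / q) - Real.log m ≤ Real.log ((m + 1) / m) := by
        rw [Real.log_div (show ((m : ℝ) + 1) ≠ 0 by positivity) (show (m : ℝ) ≠ 0 by positivity)]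
        have := Real.log_le_log (by positivity) hy'.le
        linarith
      have h2 : Real.log (((m : ℝ) + 1) / m) ≤ 1 / m := by
        have := Real.log_le_sub_one_of_pos (show (0 : ℝ) < (m + 1) / m by positivity)
        rw [show ((m : ℝ) + 1) / m - 1 = 1 / m by field_simp; ring] at this
        exact this
      linarith
    have hc' : c = Real.log x₀ - Real.log q + γ := by rw [hc, Real.log_div hx₀pos.ne' hqR.ne']
    -- combine: `|H(m) − (v + c)| ≤ 2/m ≤ 4q/(e^v x₀) ≤ Bd`
    have h2m : (2 : ℝ) / m ≤ Bd := by
      -- `m ≥ e^v x₀/q − 1 ≥ e^v x₀/(2q) ≥ e^{-κ} x₀/(2q)`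
      have hmlow : Real.exp v * x₀ / q / 2 ≤ m := by linarith
      have hev : Real.exp (-κ) ≤ Real.exp v := Real.exp_le_exp.2 hv.1
      have h1 : Real.exp (-κ) * x₀ / q / 2 ≤ m := le_trans (by gcongr) hmlow
      have hqm : Real.exp (-κ) * x₀ ≤ 2 * q * m := by
        rw [div_div, div_le_iff₀ (by positivity)] at h1; linarith
      have hx : x₀ ≤ Real.exp κ * (2 * q * m) := by
        calc x₀ = Real.exp κ * (Real.exp (-κ) * x₀) := by
              rw [← mul_assoc, ← Real.exp_add]; simp
          _ ≤ Real.exp κ * (2 * q * m) := mul_le_mul_of_nonneg_left hqm (Real.exp_pos κ).le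
      rw [hBd, div_le_div_iff₀ (by positivity) hx₀pos]
      nlinarith [hx, Real.exp_pos κ]
    rw [hGeq, hc']
    calc |∑ j ∈ Finset.Icc 1 m, (1 : ℝ) / j - (v + (Real.log x₀ - Real.log q + γ))|
        = |(∑ j ∈ Finset.Icc 1 m, (1 : ℝ) / j - (Real.log m + γ))
            + (Real.log m - (v + Real.log x₀ - Real.log q))| := by ring_nf
      _ ≤ |∑ j ∈ Finset.Icc 1 m, (1 : ℝ) / j - (Real.log m + γ)|
            + |Real.log m - (v + Real.log x₀ - Real.log q)| := abs_add_le _ _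
      _ ≤ 1 / m + 1 / m := add_le_add hH hlogm
      _ = 2 / m := by ring
      _ ≤ Bd := h2m
  -- integrate against `φ ≥ 0` of mass one, with `∫ v φ = 0`
  have hintG : IntervalIntegrable (fun v => logDensity κ v * G v) volume (-κ) κ := by
    have : (fun v => logDensity κ v * G v) = fun v => ∑ j ∈ Finset.Icc 1 (Ns / q),
        logDensity κ v * indGe (Real.log ((q * j : ℕ) : ℝ) - Real.log x₀) v / j := by
      funext v; simp only [hG, Finset.mul_sum]; refine Finset.sum_congr rfl fun j _ => ?_; ring
    rw [this]
    have := IntervalIntegrable.sum (Finset.Icc 1 (Ns / q)) hint_j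
    simpa only [Finset.sum_fn] using this
  have hintL : IntervalIntegrable (fun v => logDensity κ v * (v + c)) volume (-κ) κ :=
    ((continuous_logDensity κ).mul (continuous_id.add continuous_const)).intervalIntegrable _ _
  have hmain : ∫ v in -κ..κ, logDensity κ v * (v + c) = c := by
    have : (fun v => logDensity κ v * (v + c)) = fun v => v * logDensity κ v + c * logDensity κ v := by
      funext v; ring
    have i1 : IntervalIntegrable (fun v => v * logDensity κ v) volume (-κ) κ :=
      (continuous_id.mul (continuous_logDensity κ)).intervalIntegrable _ _
    have i2 : IntervalIntegrable (fun v => c * logDensity κ v) volume (-κ) κ :=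
      ((continuous_logDensity κ).intervalIntegrable _ _).const_mul c
    rw [this, intervalIntegral.integral_add i1 i2, integral_mul_logDensity_eq_zero hκ,
      intervalIntegral.integral_const_mul, integral_logDensity_eq_one hκ le_rfl]
    ring
  have hκκ : -κ ≤ κ := by linarith
  rw [hHsum, ← hmain, ← intervalIntegral.integral_sub hintG hintL]
  calc |∫ v in -κ..κ, logDensity κ v * G v - logDensity κ v * (v + c)|
      ≤ ∫ v in -κ..κ, |logDensity κ v * G v - logDensity κ v * (v + c)| :=
        intervalIntegral.abs_integral_le_integral_abs hκκ
    _ ≤ ∫ v in -κ..κ, logDensity κ v * Bd := by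
        refine intervalIntegral.integral_mono_on hκκ (hintG.sub hintL).abs
          (((continuous_logDensity κ).mul continuous_const).intervalIntegrable _ _) fun v hv => ?_
        rw [← mul_sub, abs_mul, abs_of_nonneg (logDensity_nonneg hκ v)]
        exact mul_le_mul_of_nonneg_left (hGv v hv) (logDensity_nonneg hκ v)
    _ = Bd := by rw [intervalIntegral.integral_mul_const, integral_logDensity_eq_one hκ le_rfl, one_mul]

/-! ### The resonant quadruples, parametrised -/

/-- Multiples: the image of `j ↦ q j` on `[1, M/q]` is the set of multiples of `q` in `[1, M]`
(`q ≥ 1`). [folklore] -/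
theorem image_mul_Icc_eq_filter {q M : ℕ} (hq : 1 ≤ q) :
    (Finset.Icc 1 (M / q)).image (fun j => q * j) = (Finset.Icc 1 M).filter (fun n => q ∣ n) := by
  ext n
  simp only [Finset.mem_image, Finset.mem_Icc, Finset.mem_filter]
  constructor
  · rintro ⟨j, ⟨hj1, hj2⟩, rfl⟩
    refine ⟨⟨?_, ?_⟩, dvd_mul_right q j⟩
    · exact le_trans hq (Nat.le_mul_of_pos_right q hj1)
    · calc q * j ≤ q * (M / q) := Nat.mul_le_mul_left q hj2
        _ ≤ M := Nat.mul_div_le M q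
  · rintro ⟨⟨hn1, hn2⟩, ⟨j, rfl⟩⟩
    refine ⟨j, ⟨?_, ?_⟩, rfl⟩
    · rcases Nat.eq_zero_or_pos j with rfl | hj
      · simp at hn1
      · exact hj
    · exact (Nat.le_div_iff_mul_le hq).2 (by rw [mul_comm]; exact hn2)

/-- Sum over the multiples of `q` in `[1, M]` as a sum over `[1, M/q]` (`q ≥ 1`). [folklore] -/
theorem sum_filter_dvd_eq_sum_mul {β : Type*} [AddCommMonoid β] {q M : ℕ} (hq : 1 ≤ q) (f : ℕ → β) :
    ∑ n ∈ (Finset.Icc 1 M).filter (fun n => q ∣ n), f n = ∑ j ∈ Finset.Icc 1 (M / q), f (q * j) := by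
  rw [← image_mul_Icc_eq_filter hq, Finset.sum_image]
  intro x _ y _ hxy
  exact Nat.eq_of_mul_eq_mul_left hq hxy

/-- **The resonant sum for a fixed pair `(k, h)`.** With `g = (k,h)`, `k' = k/g`, `h' = h/g`:
the quadruples `((ℓ, n), (k, h))` with `n h = ℓ k`, `ℓ ≤ L`, `n ≤ N_s` are `n = k' j`, `ℓ = h' j`,
`j ≤ N_s/k'` (when `N_s N ≤ L`), and on them `I2coef = a(k) ā(h)/([k,h] j)`. [folklore] -/
theorem resonant_pair_sum (a : ℕ → ℂ) (J : ℕ → ℂ) {L Ns N k h : ℕ} (hk : k ∈ Finset.Icc 1 N)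
    (hh : h ∈ Finset.Icc 1 N) (hL : Ns * N ≤ L) :
    ∑ x ∈ Finset.Icc 1 L ×ˢ Finset.Icc 1 Ns,
        (if I2res (x, (k, h)) then I2coef a (x, (k, h)) * J x.2 else 0)
      = a k * conj (a h) / (Nat.lcm k h : ℂ) *
          ∑ j ∈ Finset.Icc 1 (Ns / (k / Nat.gcd k h)), (1 / (j : ℂ)) * J (k / Nat.gcd k h * j) := by
  obtain ⟨hk1, hkN⟩ := Finset.mem_Icc.1 hk
  obtain ⟨hh1, hhN⟩ := Finset.mem_Icc.1 hh
  have hkpos : 0 < k := hk1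
  have hhpos : 0 < h := hh1
  set g : ℕ := Nat.gcd k h with hg
  have hgpos : 0 < g := Nat.gcd_pos_of_pos_left h hkpos
  set k' : ℕ := k / g with hk'
  set h' : ℕ := h / g with hh'
  have hkk : k' * g = k := Nat.div_mul_cancel (Nat.gcd_dvd_left k h)
  have hhh : h' * g = h := Nat.div_mul_cancel (Nat.gcd_dvd_right k h)
  have hk'pos : 0 < k' := Nat.pos_of_ne_zero fun h0 => by rw [h0, zero_mul] at hkk; omega
  have hh'pos : 0 < h' := Nat.pos_of_ne_zero fun h0 => by rw [h0, zero_mul] at hhh; omega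
  have hcop : Nat.Coprime k' h' := Nat.coprime_div_gcd_div_gcd hgpos
  have hlcm : Nat.lcm k h = g * k' * h' := by
    have h1 : g * Nat.lcm k h = k * h := Nat.gcd_mul_lcm k h
    have h2 : k * h = g * (g * k' * h') := by rw [← hkk, ← hhh]; ring
    rw [h2] at h1
    exact Nat.eq_of_mul_eq_mul_left hgpos h1
  -- Step 1: `∑_{(ℓ,n)} = ∑_n ∑_ℓ`, and the `ℓ`-sum has at most the term `ℓ = nh/k`
  rw [Finset.sum_product, Finset.sum_comm]
  have hℓsum : ∀ n ∈ Finset.Icc 1 Ns,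
      (∑ ℓ ∈ Finset.Icc 1 L, if I2res ((ℓ, n), (k, h)) then I2coef a ((ℓ, n), (k, h)) * J n else 0)
        = if k ∣ n * h then I2coef a ((n * h / k, n), (k, h)) * J n else 0 := by
    intro n hn
    obtain ⟨hn1, hnNs⟩ := Finset.mem_Icc.1 hn
    simp only [I2res]
    by_cases hdvd : k ∣ n * h
    · rw [if_pos hdvd]
      set ℓ₀ : ℕ := n * h / k with hℓ₀
      have hℓ₀k : ℓ₀ * k = n * h := Nat.div_mul_cancel hdvd
      have hℓ₀mem : ℓ₀ ∈ Finset.Icc 1 L := by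
        rw [Finset.mem_Icc]
        constructor
        · -- `ℓ₀ ≥ 1` since `n h ≥ 1`
          rcases Nat.eq_zero_or_pos ℓ₀ with h0 | h0
          · exfalso
            rw [h0, zero_mul] at hℓ₀k
            have : 0 < n * h := Nat.mul_pos hn1 hhpos
            omega
          · exact h0
        · calc ℓ₀ ≤ n * h := Nat.div_le_self _ _
            _ ≤ Ns * N := Nat.mul_le_mul hnNs hhN
            _ ≤ L := hL
      rw [Finset.sum_eq_single_of_mem ℓ₀ hℓ₀mem]
      · rw [if_pos hℓ₀k.symm]
      · intro ℓ _ hne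
        rw [if_neg]
        intro heq
        apply hne
        apply Nat.eq_of_mul_eq_mul_right hkpos
        rw [hℓ₀k, heq]
    · rw [if_neg hdvd]
      refine Finset.sum_eq_zero fun ℓ _ => ?_
      rw [if_neg]
      intro heq
      exact hdvd ⟨ℓ, by rw [heq, mul_comm]⟩
  rw [Finset.sum_congr rfl hℓsum]
  -- Step 2: `k ∣ n h ↔ k' ∣ n`, and the sum over multiples of `k'`
  have hdvd_iff : ∀ n : ℕ, k ∣ n * h ↔ k' ∣ n := by
    intro n
    rw [← hkk, ← hhh, show n * (h' * g) = (n * h') * g by ring]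
    rw [Nat.mul_dvd_mul_iff_right hgpos]
    exact ⟨fun hd => hcop.dvd_of_dvd_mul_right hd, fun hd => Dvd.dvd.mul_right hd _⟩
  rw [Finset.sum_congr rfl fun n _ => by rw [if_congr (hdvd_iff n) rfl rfl], ← Finset.sum_filter,
    sum_filter_dvd_eq_sum_mul hk'pos, Finset.mul_sum]
  refine Finset.sum_congr rfl fun j hj => ?_
  obtain ⟨hj1, _⟩ := Finset.mem_Icc.1 hj
  -- Step 3: on `n = k' j`: `n h / k = h' j` and the coefficient
  have hnh : k' * j * h / k = h' * j := by
    apply Nat.div_eq_of_eq_mul_left hkpos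
    rw [← hkk, ← hhh]; ring
  rw [hnh]
  have hjR : (0 : ℝ) < j := by exact_mod_cast hj1
  have hgR : (0 : ℝ) < g := by exact_mod_cast hgpos
  have hk'R : (0 : ℝ) < k' := by exact_mod_cast hk'pos
  have hh'R : (0 : ℝ) < h' := by exact_mod_cast hh'pos
  have hkR : (k : ℝ) = k' * g := by exact_mod_cast hkk.symm
  have hhR : (h : ℝ) = h' * g := by exact_mod_cast hhh.symm
  -- the real identity `(h'j)^{-1/2} (k'j)^{-1/2} k^{-1/2} h^{-1/2} = 1/(g k' h' j)`
  have hreal : ((h' * j : ℕ) : ℝ) ^ (-(1 / 2 : ℝ)) * ((k' * j : ℕ) : ℝ) ^ (-(1 / 2 : ℝ))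
      * ((k : ℝ) ^ (-(1 / 2 : ℝ)) * (h : ℝ) ^ (-(1 / 2 : ℝ))) = ((g * k' * h' : ℕ) : ℝ)⁻¹ * (j : ℝ)⁻¹ := by
    push_cast
    rw [hkR, hhR, ← Real.mul_rpow (by positivity) (by positivity), ← Real.mul_rpow (by positivity) (by positivity),
      ← Real.mul_rpow (by positivity) (by positivity)]
    -- `(x²)^{-1/2} = x⁻¹` for `x > 0` (cf. `FluidPDE.sq_rpow_neg_half_eq_inv`; three lines, inlined)
    have hsq : ∀ {x : ℝ}, 0 < x → (x ^ 2) ^ (-(1 / 2 : ℝ)) = x⁻¹ := fun {x} hx => by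
      rw [show x ^ 2 = x ^ (2 : ℝ) by norm_cast, ← Real.rpow_mul hx.le]
      norm_num
      exact Real.rpow_neg_one x
    rw [show (h' : ℝ) * j * (k' * j) * (k' * g * (h' * g)) = ((g : ℝ) * k' * h' * j) ^ 2 by ring,
      hsq (by positivity)]
    rw [mul_inv]
  simp only [I2coef, hlcm]
  -- move to `ℂ`
  have hC : ((((h' * j : ℕ) : ℝ) ^ (-(1 / 2 : ℝ)) : ℝ) : ℂ) * ((((k' * j : ℕ) : ℝ) ^ (-(1 / 2 : ℝ)) : ℝ) : ℂ)
      * (((((k : ℝ) ^ (-(1 / 2 : ℝ)) : ℝ) : ℂ)) * ((((h : ℝ) ^ (-(1 / 2 : ℝ)) : ℝ) : ℂ)))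
      = ((((g * k' * h' : ℕ) : ℝ)⁻¹ : ℝ) : ℂ) * ((((j : ℝ)⁻¹ : ℝ)) : ℂ) := by
    rw [← Complex.ofReal_mul, ← Complex.ofReal_mul, ← Complex.ofReal_mul, hreal, Complex.ofReal_mul]
  have hprod0 : ((g * k' * h' : ℕ) : ℂ) ≠ 0 := by exact_mod_cast (Nat.mul_pos (Nat.mul_pos hgpos hk'pos) hh'pos).ne'
  have hj0 : (j : ℂ) ≠ 0 := by exact_mod_cast (show j ≠ 0 by omega)
  calc ((((h' * j : ℕ) : ℝ) ^ (-(1 / 2 : ℝ)) : ℝ) : ℂ) * ((((k' * j : ℕ) : ℝ) ^ (-(1 / 2 : ℝ)) : ℝ) : ℂ)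
        * (a k * ((((k : ℝ) ^ (-(1 / 2 : ℝ)) : ℝ) : ℂ)) * (conj (a h) * ((((h : ℝ) ^ (-(1 / 2 : ℝ)) : ℝ) : ℂ))))
        * J (k' * j)
      = (((((h' * j : ℕ) : ℝ) ^ (-(1 / 2 : ℝ)) : ℝ) : ℂ) * ((((k' * j : ℕ) : ℝ) ^ (-(1 / 2 : ℝ)) : ℝ) : ℂ)
          * (((((k : ℝ) ^ (-(1 / 2 : ℝ)) : ℝ) : ℂ)) * ((((h : ℝ) ^ (-(1 / 2 : ℝ)) : ℝ) : ℂ))))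
          * (a k * conj (a h)) * J (k' * j) := by ring
    _ = ((((g * k' * h' : ℕ) : ℝ)⁻¹ : ℝ) : ℂ) * ((((j : ℝ)⁻¹ : ℝ)) : ℂ) * (a k * conj (a h)) * J (k' * j) := by
          rw [hC]
    _ = a k * conj (a h) / ((g * k' * h' : ℕ) : ℂ) * (1 / (j : ℂ) * J (k' * j)) := by
          push_cast
          field_simp

/-- **The resonant part, parametrised**: for `N_s N ≤ L_T`,
`D₂ = ∑_{k,h ≤ N} a(k) ā(h)/[k,h] ∑_{j ≤ N_s/k'} (1/j) ∫ w(t) R_κ(t/(2π(k'j)²)) dt`, `k' = k/(k,h)`.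
[folklore] -/
theorem I2diag_eq_sum_lcm (a : ℕ → ℂ) (κ : ℝ) {L Ns N : ℕ} (hL : Ns * N ≤ L) (T H : ℝ) :
    I2diag a κ L Ns N T H = ∑ k ∈ Finset.Icc 1 N, ∑ h ∈ Finset.Icc 1 N,
      a k * conj (a h) / (Nat.lcm k h : ℂ) *
        ∑ j ∈ Finset.Icc 1 (Ns / (k / Nat.gcd k h)),
          (1 / (j : ℂ)) * ∫ t, dyadicWindow T H t * prof κ (k / Nat.gcd k h * j) t := by
  unfold I2diag
  rw [Finset.sum_filter, I2set, Finset.sum_product, Finset.sum_comm, Finset.sum_product]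
  refine Finset.sum_congr rfl fun k hk => Finset.sum_congr rfl fun h hh => ?_
  exact resonant_pair_sum a (fun n => ∫ t, dyadicWindow T H t * prof κ n t) hk hh hL


/-! ### Real weighted integrals over the window -/

/-- The real window vanishes off `[T, 2T]` (`0 < H ≤ T`). [folklore] -/
theorem dyadicWindowRe_eq_zero {T H t : ℝ} (hH : 0 < H) (hHT : H ≤ T) (ht : t ∉ Set.Icc T (2 * T)) :
    dyadicWindowRe T H t = 0 := by
  have h := dyadicWindow_eq_zero hH hHT (fun h' => ht (Set.Ioo_subset_Icc_self h'))
  rw [dyadicWindow_eq_ofReal] at h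
  exact_mod_cast h

/-- The real window is continuous. [folklore] -/
theorem continuous_dyadicWindowRe (T H : ℝ) : Continuous (dyadicWindowRe T H) := by
  unfold dyadicWindowRe; fun_prop

/-- A whole-line integral against the window is an integral over `[T, 2T]` (`0 < H ≤ T`). [folklore] -/
theorem integral_wre_mul_eq_setIntegral {T H : ℝ} (hH : 0 < H) (hHT : H ≤ T) (F : ℝ → ℝ) :
    ∫ t, dyadicWindowRe T H t * F t = ∫ t in Set.Icc T (2 * T), dyadicWindowRe T H t * F t := by
  rw [setIntegral_eq_integral_of_forall_compl_eq_zero]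
  intro t ht
  rw [dyadicWindowRe_eq_zero hH hHT ht, zero_mul]

/-- Integrability of `w F` for `F` continuous on `[T, 2T]` (`0 < H ≤ T`). [folklore] -/
theorem integrable_wre_mul_of_continuousOn {T H : ℝ} (hH : 0 < H) (hHT : H ≤ T) {F : ℝ → ℝ}
    (hF : ContinuousOn F (Set.Icc T (2 * T))) : Integrable (fun t => dyadicWindowRe T H t * F t) := by
  have heq : (fun t => dyadicWindowRe T H t * F t)
      = (Set.Icc T (2 * T)).indicator (fun t => dyadicWindowRe T H t * F t) := by
    funext t
    by_cases ht : t ∈ Set.Icc T (2 * T)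
    · rw [Set.indicator_of_mem ht]
    · rw [Set.indicator_of_notMem ht, dyadicWindowRe_eq_zero hH hHT ht, zero_mul]
  rw [heq, integrable_indicator_iff measurableSet_Icc]
  exact ((continuous_dyadicWindowRe T H).continuousOn.mul hF).integrableOn_Icc

/-- The weights are continuous in `t > 0`. [folklore] -/
theorem continuousOn_weight {κ : ℝ} (hκ : 0 < κ) {n : ℕ} (hn : 1 ≤ n) :
    ContinuousOn (fun t : ℝ => weight κ n t) (Set.Ioi 0) := by
  have hc : Continuous fun t : ℝ => (prof κ n t).re :=
    Complex.continuous_re.comp (contDiff_weightProfile hκ n (m := 0)).continuous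
  refine hc.continuousOn.congr fun t ht => ?_
  show weight κ n t = (prof κ n t).re
  rw [show prof κ n t = cutoffR κ ((2 * π * (n : ℝ) ^ 2)⁻¹ * t) from rfl, ← weight_eq_cutoffR hκ hn ht,
    Complex.ofReal_re]

/-- `∫ w(t) R_κ(t/(2πn²)) dt = ∫ w(t) ρ_n(t) dt` (a real number), `n ≥ 1`, `0 < H ≤ T`. [folklore] -/
theorem integral_w_prof_eq {κ : ℝ} (hκ : 0 < κ) {n : ℕ} (hn : 1 ≤ n) {T H : ℝ} (hH : 0 < H) (hHT : H ≤ T) :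
    ∫ t, dyadicWindow T H t * prof κ n t = ((∫ t, dyadicWindowRe T H t * weight κ n t : ℝ) : ℂ) := by
  rw [← integral_complex_ofReal]
  refine integral_congr_ae (Filter.Eventually.of_forall fun t => ?_)
  show dyadicWindow T H t * prof κ n t = ((dyadicWindowRe T H t * weight κ n t : ℝ) : ℂ)
  rcases le_or_gt t 0 with ht | ht
  · have hT : 0 < T := hH.trans_le hHT
    rw [dyadicWindow_eq_zero_of_le hH hHT (by linarith), zero_mul,
      dyadicWindowRe_eq_zero hH hHT (fun h => by linarith [h.1]), zero_mul, Complex.ofReal_zero]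
  · rw [dyadicWindow_eq_ofReal, Complex.ofReal_mul,
      show prof κ n t = cutoffR κ ((2 * π * (n : ℝ) ^ 2)⁻¹ * t) from rfl, ← weight_eq_cutoffR hκ hn ht]

/-- `∑_{j ≤ N_s/q} (1/j) ∫ w ρ_{qj} = ∫ w(t) H_q(t) dt` (`q ≥ 1`, `0 < H ≤ T`). [folklore] -/
theorem sum_integral_w_prof_eq {κ : ℝ} (hκ : 0 < κ) {q : ℕ} (hq : 1 ≤ q) (Ns : ℕ) {T H : ℝ}
    (hH : 0 < H) (hHT : H ≤ T) :
    ∑ j ∈ Finset.Icc 1 (Ns / q), (1 / (j : ℂ)) * ∫ t, dyadicWindow T H t * prof κ (q * j) t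
      = ((∫ t, dyadicWindowRe T H t * Hsum κ q Ns t : ℝ) : ℂ) := by
  have hT : 0 < T := hH.trans_le hHT
  have hintj : ∀ j ∈ Finset.Icc 1 (Ns / q),
      Integrable (fun t => dyadicWindowRe T H t * (weight κ (q * j) t / j)) := by
    intro j hj
    have hj := (Finset.mem_Icc.1 hj).1
    refine integrable_wre_mul_of_continuousOn hH hHT ?_
    refine ContinuousOn.div_const ((continuousOn_weight hκ ?_).mono fun t ht => ?_) _
    · exact le_trans hq (Nat.le_mul_of_pos_right q hj)
    · exact Set.mem_Ioi.2 (hT.trans_le ht.1)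
  have hsum : (∫ t, dyadicWindowRe T H t * Hsum κ q Ns t)
      = ∑ j ∈ Finset.Icc 1 (Ns / q), ∫ t, dyadicWindowRe T H t * (weight κ (q * j) t / j) := by
    rw [← integral_finsetSum _ hintj]
    refine integral_congr_ae (Filter.Eventually.of_forall fun t => ?_)
    simp only [Hsum_def, Finset.mul_sum]
  rw [hsum, Complex.ofReal_sum]
  refine Finset.sum_congr rfl fun j hj => ?_
  have hj1 := (Finset.mem_Icc.1 hj).1
  rw [integral_w_prof_eq hκ (le_trans hq (Nat.le_mul_of_pos_right q hj1)) hH hHT, ← Complex.ofReal_natCast,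
    ← Complex.ofReal_one, ← Complex.ofReal_div, ← Complex.ofReal_mul, ← MeasureTheory.integral_const_mul]
  congr 1
  refine integral_congr_ae (Filter.Eventually.of_forall fun t => ?_)
  show 1 / (j : ℝ) * (dyadicWindowRe T H t * weight κ (q * j) t) = dyadicWindowRe T H t * (weight κ (q * j) t / j)
  ring

/-! ### `2 Re D₂` and the pointwise quadratic form -/

/-- The kernel splits: `log(t g²/(2πkh)) + 2γ = (log(x₀/k') + γ) + (log(x₀/h') + γ)` with
`x₀ = √(t/2π)`, `k = gk'`, `h = gh'`. [folklore] -/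
theorem kernel_split {t : ℝ} (ht : 0 < t) {g k' h' : ℕ} (hg : 0 < g) (hk' : 0 < k') (hh' : 0 < h') :
    Real.log (t * (g : ℝ) ^ 2 / (2 * π * ((k' * g : ℕ) : ℝ) * ((h' * g : ℕ) : ℝ))) + 2 * Real.eulerMascheroniConstant
      = (Real.log (Real.sqrt (t / (2 * π)) / k') + Real.eulerMascheroniConstant)
        + (Real.log (Real.sqrt (t / (2 * π)) / h') + Real.eulerMascheroniConstant) := by
  have hπ := Real.pi_pos
  have hx : 0 < Real.sqrt (t / (2 * π)) := Real.sqrt_pos.2 (by positivity)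
  have hgR : (0 : ℝ) < g := by exact_mod_cast hg
  have hk'R : (0 : ℝ) < k' := by exact_mod_cast hk'
  have hh'R : (0 : ℝ) < h' := by exact_mod_cast hh'
  have e1 : t * (g : ℝ) ^ 2 / (2 * π * ((k' * g : ℕ) : ℝ) * ((h' * g : ℕ) : ℝ))
      = (Real.sqrt (t / (2 * π)) / k') * (Real.sqrt (t / (2 * π)) / h') := by
    have hsq : Real.sqrt (t / (2 * π)) ^ 2 = t / (2 * π) := Real.sq_sqrt (by positivity)
    rw [div_mul_div_comm, ← pow_two, hsq]
    push_cast
    field_simp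
  rw [e1, Real.log_mul (by positivity) (by positivity)]
  ring

/-- **`2 Re D₂` is the windowed integral of the pointwise quadratic form**, up to
`8 e^κ T (∑|a(k)|)(∑|a(h)|/h)/x₀(T)`. Hypotheses: `N_s N ≤ L_T`, and for `t ∈ [T, 2T]`:
`e^κ x₀(t) ≤ N_s` and `2N ≤ e^{-κ} x₀(t)`, `x₀(t) = √(t/2π)`. [folklore] -/
theorem two_re_I2diag_sub_le (a : ℕ → ℂ) {κ : ℝ} (hκ : 0 < κ) {Ns N : ℕ}
    {T H : ℝ} (hH : 0 < H) (hHT : H ≤ T) (hL : Ns * N ≤ emLen T)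
    (hcov : ∀ t ∈ Set.Icc T (2 * T), Real.exp κ * Real.sqrt (t / (2 * π)) ≤ Ns)
    (hsmall : ∀ t ∈ Set.Icc T (2 * T), 2 * (N : ℝ) ≤ Real.exp (-κ) * Real.sqrt (t / (2 * π))) :
    |2 * (I2diag a κ (emLen T) Ns N T H).re
        - ∫ t, dyadicWindowRe T H t * bchQuadForm (Real.exp 1 * t / 4) N a|
      ≤ 8 * Real.exp κ * T / Real.sqrt (T / (2 * π))
          * ((∑ k ∈ Finset.Icc 1 N, ‖a k‖) * ∑ h ∈ Finset.Icc 1 N, ‖a h‖ / h) := by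
  have hπ := Real.pi_pos
  have hT : 0 < T := hH.trans_le hHT
  set x₀T : ℝ := Real.sqrt (T / (2 * π)) with hx₀T
  have hx₀T_pos : 0 < x₀T := Real.sqrt_pos.2 (by positivity)
  set wre := dyadicWindowRe T H with hwre
  set G : ℕ → ℝ := fun q => ∫ t, wre t * Hsum κ q Ns t with hG
  set gg : ℕ → ℕ → ℕ := fun k h => Nat.gcd k h with hgg
  set kp : ℕ → ℕ → ℕ := fun k h => k / Nat.gcd k h with hkp
  -- (1) the parametrised resonant part
  have hI : I2diag a κ (emLen T) Ns N T H = ∑ k ∈ Finset.Icc 1 N, ∑ h ∈ Finset.Icc 1 N,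
      a k * conj (a h) / (Nat.lcm k h : ℂ) * ((G (kp k h) : ℝ) : ℂ) := by
    rw [I2diag_eq_sum_lcm a κ hL T H]
    refine Finset.sum_congr rfl fun k hk => Finset.sum_congr rfl fun h hh => ?_
    have hkpos := (Finset.mem_Icc.1 hk).1
    have hgpos : 0 < Nat.gcd k h := Nat.gcd_pos_of_pos_left h hkpos
    have hk'pos : 1 ≤ k / Nat.gcd k h := Nat.div_pos (Nat.le_of_dvd hkpos (Nat.gcd_dvd_left k h)) hgpos
    rw [sum_integral_w_prof_eq hκ hk'pos Ns hH hHT]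
  -- (2) the real part and its symmetrisation
  set Are : ℕ → ℕ → ℝ := fun k h => (a k * conj (a h)).re / (Nat.lcm k h : ℝ) with hAre
  have hre : (I2diag a κ (emLen T) Ns N T H).re = ∑ k ∈ Finset.Icc 1 N, ∑ h ∈ Finset.Icc 1 N,
      Are k h * G (kp k h) := by
    rw [hI, Complex.re_sum]
    refine Finset.sum_congr rfl fun k _ => ?_
    rw [Complex.re_sum]
    refine Finset.sum_congr rfl fun h _ => ?_
    rw [Complex.mul_re, Complex.ofReal_re, Complex.ofReal_im, mul_zero, sub_zero,
      ← Complex.ofReal_natCast, Complex.div_ofReal_re]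
  have hsymm : ∑ k ∈ Finset.Icc 1 N, ∑ h ∈ Finset.Icc 1 N, Are k h * G (kp k h)
      = ∑ k ∈ Finset.Icc 1 N, ∑ h ∈ Finset.Icc 1 N, Are k h * G (kp h k) := by
    rw [Finset.sum_comm]
    refine Finset.sum_congr rfl fun k _ => Finset.sum_congr rfl fun h _ => ?_
    -- `Are h k = Are k h`
    have : Are h k = Are k h := by
      simp only [hAre, Nat.lcm_comm h k]
      congr 1
      rw [← Complex.conj_re (a h * conj (a k)), map_mul, Complex.conj_conj, mul_comm]
    rw [this]
  have h2re : 2 * (I2diag a κ (emLen T) Ns N T H).re = ∑ k ∈ Finset.Icc 1 N, ∑ h ∈ Finset.Icc 1 N,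
      Are k h * (G (kp k h) + G (kp h k)) := by
    rw [two_mul, hre]
    conv_lhs => rw [hsymm] ; rw [← hsymm]
    rw [show (∑ k ∈ Finset.Icc 1 N, ∑ h ∈ Finset.Icc 1 N, Are k h * G (kp k h))
        + ∑ k ∈ Finset.Icc 1 N, ∑ h ∈ Finset.Icc 1 N, Are k h * G (kp k h)
        = (∑ k ∈ Finset.Icc 1 N, ∑ h ∈ Finset.Icc 1 N, Are k h * G (kp k h))
        + ∑ k ∈ Finset.Icc 1 N, ∑ h ∈ Finset.Icc 1 N, Are k h * G (kp h k) by rw [hsymm]]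
    rw [← Finset.sum_add_distrib]
    refine Finset.sum_congr rfl fun k _ => ?_
    rw [← Finset.sum_add_distrib]
    refine Finset.sum_congr rfl fun h _ => ?_
    ring
  -- (3) the quadratic form integral
  have hQ : (∫ t, wre t * bchQuadForm (Real.exp 1 * t / 4) N a) = ∑ k ∈ Finset.Icc 1 N, ∑ h ∈ Finset.Icc 1 N,
      Are k h * ∫ t, wre t * (Real.log (t * (Nat.gcd k h : ℝ) ^ 2 / (2 * π * k * h)) + 2 * Real.eulerMascheroniConstant) := by
    have hK : ∀ k ∈ Finset.Icc 1 N, ∀ h ∈ Finset.Icc 1 N, Integrable fun t => wre t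
        * (Are k h * (Real.log (t * (Nat.gcd k h : ℝ) ^ 2 / (2 * π * k * h)) + 2 * Real.eulerMascheroniConstant)) := by
      intro k hk h hh
      have hk0 : (0 : ℝ) < k := by exact_mod_cast (Finset.mem_Icc.1 hk).1
      have hh0 : (0 : ℝ) < h := by exact_mod_cast (Finset.mem_Icc.1 hh).1
      have hg0 : (0 : ℝ) < (Nat.gcd k h : ℝ) := by exact_mod_cast Nat.gcd_pos_of_pos_left h (Finset.mem_Icc.1 hk).1
      refine integrable_wre_mul_of_continuousOn hH hHT (continuousOn_const.mul (ContinuousOn.add ?_ continuousOn_const))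
      refine ContinuousOn.log (by fun_prop) fun t ht => ?_
      have : 0 < t := hT.trans_le ht.1
      positivity
    have hpt : ∀ t, wre t * bchQuadForm (Real.exp 1 * t / 4) N a = ∑ k ∈ Finset.Icc 1 N, ∑ h ∈ Finset.Icc 1 N,
        wre t * (Are k h * (Real.log (t * (Nat.gcd k h : ℝ) ^ 2 / (2 * π * k * h)) + 2 * Real.eulerMascheroniConstant)) := by
      intro t
      rcases le_or_gt t 0 with ht | ht
      · have : wre t = 0 := dyadicWindowRe_eq_zero hH hHT (fun h => by linarith [h.1])
        simp [this]
      · rw [PropB.bchQuadForm_rescale ht, Finset.mul_sum]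
        refine Finset.sum_congr rfl fun k _ => ?_
        rw [Finset.mul_sum]
    rw [show (fun t => wre t * bchQuadForm (Real.exp 1 * t / 4) N a) = fun t => ∑ k ∈ Finset.Icc 1 N,
        ∑ h ∈ Finset.Icc 1 N, wre t * (Are k h * (Real.log (t * (Nat.gcd k h : ℝ) ^ 2 / (2 * π * k * h))
          + 2 * Real.eulerMascheroniConstant)) from funext hpt]
    rw [integral_finsetSum _ fun k hk => integrable_finsetSum _ fun h hh => hK k hk h hh]
    refine Finset.sum_congr rfl fun k hk => ?_
    rw [integral_finsetSum _ fun h hh => hK k hk h hh]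
    refine Finset.sum_congr rfl fun h hh => ?_
    rw [← MeasureTheory.integral_const_mul]
    refine integral_congr_ae (Filter.Eventually.of_forall fun t => ?_)
    show wre t * (Are k h * _) = Are k h * (wre t * _)
    ring
  -- (4) termwise comparison
  rw [h2re, hQ, ← Finset.sum_sub_distrib]
  have hterm : ∀ k ∈ Finset.Icc 1 N, ∀ h ∈ Finset.Icc 1 N,
      |Are k h * (G (kp k h) + G (kp h k))
        - Are k h * ∫ t, wre t * (Real.log (t * (Nat.gcd k h : ℝ) ^ 2 / (2 * π * k * h)) + 2 * Real.eulerMascheroniConstant)|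
        ≤ ‖a k‖ * ‖a h‖ * (1 / h + 1 / k) * (4 * Real.exp κ * T / x₀T) := by
    intro k hk h hh
    obtain ⟨hk1, hkN⟩ := Finset.mem_Icc.1 hk
    obtain ⟨hh1, hhN⟩ := Finset.mem_Icc.1 hh
    have hk0 : (0 : ℝ) < k := by exact_mod_cast hk1
    have hh0 : (0 : ℝ) < h := by exact_mod_cast hh1
    set g : ℕ := Nat.gcd k h with hg
    have hgpos : 0 < g := Nat.gcd_pos_of_pos_left h hk1
    set k' : ℕ := k / g with hk'
    set h' : ℕ := h / g with hh'
    have hkk : k' * g = k := Nat.div_mul_cancel (Nat.gcd_dvd_left k h)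
    have hhh : h' * g = h := Nat.div_mul_cancel (Nat.gcd_dvd_right k h)
    have hk'pos : 0 < k' := Nat.pos_of_ne_zero fun h0 => by rw [h0, zero_mul] at hkk; omega
    have hh'pos : 0 < h' := Nat.pos_of_ne_zero fun h0 => by rw [h0, zero_mul] at hhh; omega
    have hkph : kp h k = h' := by
      show h / Nat.gcd h k = h / g
      rw [Nat.gcd_comm]
    have hkpk : kp k h = k' := rfl
    have hlcm : (Nat.lcm k h : ℝ) = g * k' * h' := by
      have h1 : g * Nat.lcm k h = k * h := Nat.gcd_mul_lcm k h
      have h2 : k * h = g * (g * k' * h') := by rw [← hkk, ← hhh]; ring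
      rw [h2] at h1
      exact_mod_cast Nat.eq_of_mul_eq_mul_left hgpos h1
    have hk'le : (k' : ℝ) ≤ N := by exact_mod_cast (Nat.div_le_self k g).trans hkN
    have hh'le : (h' : ℝ) ≤ N := by exact_mod_cast (Nat.div_le_self h g).trans hhN
    -- the integrand difference pointwise on `[T, 2T]`
    have hHk : ∀ t ∈ Set.Icc T (2 * T), |Hsum κ k' Ns t - (Real.log (Real.sqrt (t / (2 * π)) / k') + Real.eulerMascheroniConstant)|
        ≤ 4 * Real.exp κ * k' / Real.sqrt (t / (2 * π)) := fun t ht =>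
      abs_Hsum_sub_le hκ hk'pos (hT.trans_le ht.1) (hcov t ht) (le_trans (by linarith) (hsmall t ht))
    have hHh : ∀ t ∈ Set.Icc T (2 * T), |Hsum κ h' Ns t - (Real.log (Real.sqrt (t / (2 * π)) / h') + Real.eulerMascheroniConstant)|
        ≤ 4 * Real.exp κ * h' / Real.sqrt (t / (2 * π)) := fun t ht =>
      abs_Hsum_sub_le hκ hh'pos (hT.trans_le ht.1) (hcov t ht) (le_trans (by linarith) (hsmall t ht))
    -- integrability of the three pieces
    have hcontH : ∀ q : ℕ, 1 ≤ q → ContinuousOn (fun t => Hsum κ q Ns t) (Set.Icc T (2 * T)) := by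
      intro q hq
      unfold Hsum
      refine continuousOn_finsetSum _ fun j hj => ?_
      have hj := (Finset.mem_Icc.1 hj).1
      exact ((continuousOn_weight hκ (le_trans hq (Nat.le_mul_of_pos_right q hj))).mono
        fun t ht => Set.mem_Ioi.2 (hT.trans_le ht.1)).div_const _
    have hiK : Integrable fun t => wre t * (Real.log (t * (g : ℝ) ^ 2 / (2 * π * k * h)) + 2 * Real.eulerMascheroniConstant) := by
      refine integrable_wre_mul_of_continuousOn hH hHT (ContinuousOn.add ?_ continuousOn_const)
      have hg0 : (0 : ℝ) < g := by exact_mod_cast hgpos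
      refine ContinuousOn.log (by fun_prop) fun t ht => ?_
      have : 0 < t := hT.trans_le ht.1
      positivity
    have hiHk : Integrable fun t => wre t * Hsum κ k' Ns t := integrable_wre_mul_of_continuousOn hH hHT (hcontH k' hk'pos)
    have hiHh : Integrable fun t => wre t * Hsum κ h' Ns t := integrable_wre_mul_of_continuousOn hH hHT (hcontH h' hh'pos)
    -- the difference of integrals
    have hdiff : G (kp k h) + G (kp h k)
        - (∫ t, wre t * (Real.log (t * (g : ℝ) ^ 2 / (2 * π * k * h)) + 2 * Real.eulerMascheroniConstant))
        = ∫ t, wre t * ((Hsum κ k' Ns t - (Real.log (Real.sqrt (t / (2 * π)) / k') + Real.eulerMascheroniConstant))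
            + (Hsum κ h' Ns t - (Real.log (Real.sqrt (t / (2 * π)) / h') + Real.eulerMascheroniConstant))) := by
      rw [hkpk, hkph]
      simp only [hG]
      have hi12 : Integrable (fun t => wre t * Hsum κ k' Ns t + wre t * Hsum κ h' Ns t) := hiHk.add hiHh
      rw [← integral_add hiHk hiHh, ← integral_sub hi12 hiK]
      refine integral_congr_ae (Filter.Eventually.of_forall fun t => ?_)
      show wre t * Hsum κ k' Ns t + wre t * Hsum κ h' Ns t
          - wre t * (Real.log (t * (g : ℝ) ^ 2 / (2 * π * k * h)) + 2 * Real.eulerMascheroniConstant) = _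
      rcases le_or_gt t 0 with ht | ht
      · have : wre t = 0 := dyadicWindowRe_eq_zero hH hHT (fun h => by linarith [h.1])
        simp [this]
      · have hks := kernel_split ht hgpos hk'pos hh'pos
        rw [hkk, hhh] at hks
        rw [hks]; ring
    -- bound
    have hbound : |G (kp k h) + G (kp h k)
        - (∫ t, wre t * (Real.log (t * (g : ℝ) ^ 2 / (2 * π * k * h)) + 2 * Real.eulerMascheroniConstant))|
        ≤ 4 * Real.exp κ * ((k' : ℝ) + h') / x₀T * T := by
      rw [hdiff, integral_wre_mul_eq_setIntegral hH hHT]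
      have hvol : volume.real (Set.Icc T (2 * T)) = T := by
        rw [Real.volume_real_Icc_of_le (by linarith)]; ring
      have hn : ‖∫ t in Set.Icc T (2 * T), wre t * ((Hsum κ k' Ns t
            - (Real.log (Real.sqrt (t / (2 * π)) / k') + Real.eulerMascheroniConstant))
            + (Hsum κ h' Ns t - (Real.log (Real.sqrt (t / (2 * π)) / h') + Real.eulerMascheroniConstant)))‖
          ≤ (4 * Real.exp κ * ((k' : ℝ) + h') / x₀T) * volume.real (Set.Icc T (2 * T)) :=
        norm_setIntegral_le_of_norm_le_const (by rw [Real.volume_Icc]; exact ENNReal.ofReal_lt_top)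
        (fun t ht => by
          have hw01 := dyadicWindowRe_mem_Icc hH hHT t
          have hxt : x₀T ≤ Real.sqrt (t / (2 * π)) := Real.sqrt_le_sqrt (by
            rw [div_le_div_iff_of_pos_right (by positivity)]; exact ht.1)
          have hxtpos : 0 < Real.sqrt (t / (2 * π)) := hx₀T_pos.trans_le hxt
          rw [Real.norm_eq_abs, abs_mul, abs_of_nonneg hw01.1]
          have h1 := hHk t ht
          have h2 := hHh t ht
          have h3 : 4 * Real.exp κ * k' / Real.sqrt (t / (2 * π)) + 4 * Real.exp κ * h' / Real.sqrt (t / (2 * π))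
              ≤ 4 * Real.exp κ * ((k' : ℝ) + h') / x₀T := by
            rw [← add_div, show 4 * Real.exp κ * (k' : ℝ) + 4 * Real.exp κ * h' = 4 * Real.exp κ * ((k' : ℝ) + h') by ring]
            exact div_le_div_of_nonneg_left (by positivity) hx₀T_pos hxt
          calc wre t * |(Hsum κ k' Ns t - (Real.log (Real.sqrt (t / (2 * π)) / k') + Real.eulerMascheroniConstant))
                + (Hsum κ h' Ns t - (Real.log (Real.sqrt (t / (2 * π)) / h') + Real.eulerMascheroniConstant))|
              ≤ 1 * (4 * Real.exp κ * ((k' : ℝ) + h') / x₀T) := by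
                refine mul_le_mul hw01.2 ((abs_add_le _ _).trans ((add_le_add h1 h2).trans h3)) (abs_nonneg _) zero_le_one
            _ = _ := one_mul _)
      rw [Real.norm_eq_abs, hvol] at hn
      exact hn
    -- `|Are| ≤ |a k||a h|/lcm` and `(k' + h')/lcm = 1/h + 1/k`
    have hAre_le : |Are k h| ≤ ‖a k‖ * ‖a h‖ / (Nat.lcm k h : ℝ) := by
      simp only [hAre, abs_div, Nat.abs_cast]
      refine div_le_div_of_nonneg_right ?_ (by positivity)
      calc |(a k * conj (a h)).re| ≤ ‖a k * conj (a h)‖ := Complex.abs_re_le_norm _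
        _ = ‖a k‖ * ‖a h‖ := by rw [norm_mul, Complex.norm_conj]
    have hratio : ((k' : ℝ) + h') / (Nat.lcm k h : ℝ) = 1 / h + 1 / k := by
      rw [hlcm]
      have hgR : (0 : ℝ) < g := by exact_mod_cast hgpos
      have hk'R : (0 : ℝ) < k' := by exact_mod_cast hk'pos
      have hh'R : (0 : ℝ) < h' := by exact_mod_cast hh'pos
      have hkR : (k : ℝ) = k' * g := by exact_mod_cast hkk.symm
      have hhR : (h : ℝ) = h' * g := by exact_mod_cast hhh.symm
      rw [hkR, hhR]
      field_simp
    rw [← mul_sub, abs_mul]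
    calc |Are k h| * |G (kp k h) + G (kp h k)
          - ∫ t, wre t * (Real.log (t * (g : ℝ) ^ 2 / (2 * π * k * h)) + 2 * Real.eulerMascheroniConstant)|
        ≤ (‖a k‖ * ‖a h‖ / (Nat.lcm k h : ℝ)) * (4 * Real.exp κ * ((k' : ℝ) + h') / x₀T * T) :=
          mul_le_mul hAre_le hbound (abs_nonneg _) (by positivity)
      _ = ‖a k‖ * ‖a h‖ * (((k' : ℝ) + h') / (Nat.lcm k h : ℝ)) * (4 * Real.exp κ * T / x₀T) := by ring
      _ = ‖a k‖ * ‖a h‖ * (1 / h + 1 / k) * (4 * Real.exp κ * T / x₀T) := by rw [hratio]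
  -- (5) sum up
  calc |∑ k ∈ Finset.Icc 1 N, (∑ h ∈ Finset.Icc 1 N, Are k h * (G (kp k h) + G (kp h k))
          - ∑ h ∈ Finset.Icc 1 N, Are k h * ∫ t, wre t * (Real.log (t * (Nat.gcd k h : ℝ) ^ 2 / (2 * π * k * h))
              + 2 * Real.eulerMascheroniConstant))|
      ≤ ∑ k ∈ Finset.Icc 1 N, ∑ h ∈ Finset.Icc 1 N, ‖a k‖ * ‖a h‖ * (1 / h + 1 / k) * (4 * Real.exp κ * T / x₀T) := by
        refine (Finset.abs_sum_le_sum_abs _ _).trans (Finset.sum_le_sum fun k hk => ?_)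
        rw [← Finset.sum_sub_distrib]
        exact (Finset.abs_sum_le_sum_abs _ _).trans (Finset.sum_le_sum fun h hh => hterm k hk h hh)
    _ = 8 * Real.exp κ * T / x₀T * ((∑ k ∈ Finset.Icc 1 N, ‖a k‖) * ∑ h ∈ Finset.Icc 1 N, ‖a h‖ / h) := by
        -- split `1/h + 1/k` and use symmetry
        have hsplit : ∑ k ∈ Finset.Icc 1 N, ∑ h ∈ Finset.Icc 1 N, ‖a k‖ * ‖a h‖ * (1 / h + 1 / k) * (4 * Real.exp κ * T / x₀T)
            = (4 * Real.exp κ * T / x₀T) * (∑ k ∈ Finset.Icc 1 N, ∑ h ∈ Finset.Icc 1 N, ‖a k‖ * (‖a h‖ / h))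
              + (4 * Real.exp κ * T / x₀T) * (∑ k ∈ Finset.Icc 1 N, ∑ h ∈ Finset.Icc 1 N, (‖a k‖ / k) * ‖a h‖) := by
          rw [Finset.mul_sum, Finset.mul_sum, ← Finset.sum_add_distrib]
          refine Finset.sum_congr rfl fun k _ => ?_
          rw [Finset.mul_sum, Finset.mul_sum, ← Finset.sum_add_distrib]
          refine Finset.sum_congr rfl fun h _ => ?_
          ring
        have hs1 : ∑ k ∈ Finset.Icc 1 N, ∑ h ∈ Finset.Icc 1 N, ‖a k‖ * (‖a h‖ / h)
            = (∑ k ∈ Finset.Icc 1 N, ‖a k‖) * ∑ h ∈ Finset.Icc 1 N, ‖a h‖ / h := by rw [Finset.sum_mul_sum]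
        have hs2 : ∑ k ∈ Finset.Icc 1 N, ∑ h ∈ Finset.Icc 1 N, (‖a k‖ / k) * ‖a h‖
            = (∑ k ∈ Finset.Icc 1 N, ‖a k‖) * ∑ h ∈ Finset.Icc 1 N, ‖a h‖ / h := by
          rw [Finset.sum_comm, Finset.sum_mul_sum]
          refine Finset.sum_congr rfl fun k _ => Finset.sum_congr rfl fun h _ => ?_
          ring
        rw [hsplit, hs1, hs2]
        ring


end PropBResonant

end Literature.Barriers.RiemannHypothesis
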